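import Literature.MathematicalPhysics.QuantumLattice.AngularSectors
import Mathlib.Analysis.Calculus.BumpFunction.InnerProduct
import Mathlib.Analysis.Calculus.IteratedDeriv.Lemmas
import Mathlib.Analysis.Calculus.Deriv.Support
import Mathlib.Analysis.Normed.Group.Bounded
import Mathlib.Algebra.Order.Round
import Mathlib.Topology.Algebra.InfiniteSum.Real
import Mathlib.MeasureTheory.Integral.IntervalIntegral.Basic
import Mathlib.Order.Interval.Finset.Basic
import HarnessLib

/-!
# The smooth partition of unity subordinate to the angular sectors
(Benfatto–Giuliani–Mastropietro 2006, (2.45)), with scale-covariant derivative bounds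

Topic `Literature/MathematicalPhysics/QuantumLattice`; continues `AngularSectors.lean` (dyadic
sectors of width `w_n = π/2^n = πγ^{h/2}`, `γ = 4`, `n = -h`, centres `(ω + ½)w_n`,
`2^{n+1}` of them per turn).

BGM 2006, §2.5 (2.45) (p. 10 of the arXiv text): "we introduce the functions `ζ_{h,ω}(θ)` with the
properties: `‖θ - θ_{h,ω}‖ < (π/4)γ^{h/2} ⟹ ζ_{h,ω}(θ) = 1`; `‖θ - θ_{h,ω}‖ > (3π/4)γ^{h/2} ⟹
ζ_{h,ω}(θ) = 0`; `Σ_{ω ∈ O_h} ζ_{h,ω}(θ) = 1 ∀ θ ∈ 𝕋¹`". The integration-by-parts bounds of the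
sector propagators (Lemma 2.2, (2.49)–(2.51); BGM 2003 §7.2) use in addition that each
`θ`-derivative of `ζ_{h,ω}` costs a factor `γ^{-h/2}`.

CONSTRUCTION (standard): one smooth profile `Z₁ = b₁ / S₁` on `ℝ` — `b₁` a bump equal to `1` on
`|r| ≤ ½` and supported in `|r| < ¾` (the explicit plateau function
`b₁(r) = smoothTransition((9 - 16r²)/5)` built from Mathlib's `Real.smoothTransition`, so that numeral
bounds on its derivatives are available to consumers), `S₁(r) = Σ_{j ∈ ℤ} b₁(r - j) ≥ 1` its
locally finite `1`-periodic sum — and then `ζ_{n,j}(θ) = Z₁(θ/w_n - j - ½)` for every integer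
`j`, a partition of unity on the LINE subordinate to the intervals of length `w_n` centred at
`(j + ½)w_n`, `2π`-covariant in the sense `ζ_{n,j+N}(θ + 2π) = ζ_{n,j}(θ)`, `N = 2^{n+1}` (so the
circle functions of (2.45) are `θ ↦ Σ_k ζ_{n,ω+kN}(θ)`, `ω ∈ O_h`; every bound below transfers).
PROVED:

* `sectorProfile`, `sectorProfileSum`, `sectorUnitWeight` (`Z₁`): smooth (`contDiff_sectorUnitWeight`, locally
  finite sums), `0 ≤ Z₁ ≤ 1`, `Z₁ = 1` on `|r| ≤ ¼`, `Z₁ = 0` on `|r| ≥ ¾`, and the partition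
  identity `Σ_{j ∈ ℤ} Z₁(r - j) = 1` (`tsum_sectorUnitWeight_sub_int`); every derivative of `Z₁` is
  bounded (`exists_bound_iteratedDeriv_sectorUnitWeight`);
* `sectorWeight n j` (`ζ_{n,j}`): smooth, `[0,1]`-valued, **plateau** `|θ - (j+½)w_n| ≤ w_n/4 ⟹ ζ = 1`
  (BGM's first property with room to spare), **support** `|θ - (j+½)w_n| ≥ 3w_n/4 ⟹ ζ = 0` (the
  second), **partition of unity** `Σ_{j ∈ ℤ} ζ_{n,j}(θ) = 1` (the third, on the line),
  `sectorWeight_add_sectorCount_add_two_pi` (covariance), and the **scale-covariant derivative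
  bounds** `|ζ_{n,j}^{(m)}(θ)| ≤ C_m w_n^{-m} = C_m (2^n/π)^m` (`abs_iteratedDeriv_sectorWeight_le`);
* **decomposition of period integrals** (`intervalIntegral_period_eq_sum_sectorWeight`): for a
  continuous `2π`-periodic `g`, `∫₀^{2π} g = Σ_{ω<N} ∫_{-2π}^{4π} ζ_{n,ω}(θ) g(θ) dθ` — the form in
  which the line family implements `Σ_{ω ∈ O_h} ζ_{h,ω} = 1` on `𝕋¹` for all integrals over the
  circle (`sum_sectorWeight_shifts_eq_one`: `Σ_{ω<N} (ζ_{n,ω-N} + ζ_{n,ω} + ζ_{n,ω+N})(θ) = 1` on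
  `[0, 2π]`).

Everything is PROVED; the definitions have bodies.

## Sources

* G. Benfatto, A. Giuliani, V. Mastropietro, Ann. Henri Poincaré 7 (2006) 809–898, §2.5 (2.45)
  and Lemma 2.2 (arXiv:cond-mat/0507686 pp. 10–11). [BenfattoGiulianiMastropietro2006]
* G. Benfatto, A. Giuliani, V. Mastropietro, Ann. Henri Poincaré 4 (2003) 137–193, (3.44a) and
  §7.2 (derivative costs of the sector cutoffs). [BenfattoGiulianiMastropietro2003]
-/

noncomputable section

open Real Set Filter Metric
open scoped Topology

namespace Literature.MathematicalPhysics.QuantumLattice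

/-! ### §1 The profile `b₁` -/

/-- The profile `b₁ : ℝ → [0,1]`: the explicit smooth plateau function
`b₁(r) = smoothTransition ((9 - 16 r²) / 5)` — its argument is `≥ 1` exactly when `|r| ≤ ½` and `≤ 0`
exactly when `|r| ≥ ¾`, so `b₁ = 1` on `|r| ≤ ½`, `b₁ = 0` on `|r| ≥ ¾`, `0 < b₁` on `|r| < ¾`, `b₁` is
smooth, even, `[0,1]`-valued. (An explicit formula rather than an abstract `ContDiffBump`, whose
profile Mathlib only provides through `Classical.choice`: with this body numeral bounds on the
derivatives of `b₁` are theorems.) [folklore] -/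
def sectorProfile (r : ℝ) : ℝ := Real.smoothTransition ((9 - 16 * r ^ 2) / 5)

/-- `b₁` is smooth. [folklore] -/
theorem contDiff_sectorProfile {m : ℕ∞} : ContDiff ℝ m sectorProfile :=
  Real.smoothTransition.contDiff.comp
    (show ContDiff ℝ m (fun r : ℝ => (9 - 16 * r ^ 2) / 5) from
      (contDiff_const.sub (contDiff_const.mul (contDiff_id.pow 2))).div_const _)

/-- `b₁ = 1` on `|r| ≤ ½`. [folklore] -/
theorem sectorProfile_eq_one {r : ℝ} (hr : |r| ≤ 1 / 2) : sectorProfile r = 1 := by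
  have h := abs_le.1 hr
  exact Real.smoothTransition.one_of_one_le (by nlinarith [h.1, h.2])

/-- `b₁ = 0` on `|r| ≥ ¾`. [folklore] -/
theorem sectorProfile_eq_zero {r : ℝ} (hr : 3 / 4 ≤ |r|) : sectorProfile r = 0 := by
  have h : (3 / 4 : ℝ) ^ 2 ≤ r ^ 2 := by
    rw [← sq_abs r]
    exact pow_le_pow_left₀ (by norm_num) hr 2
  exact Real.smoothTransition.zero_of_nonpos (by nlinarith [h])

/-- `0 ≤ b₁`. [folklore] -/
theorem sectorProfile_nonneg (r : ℝ) : 0 ≤ sectorProfile r := Real.smoothTransition.nonneg _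

/-- `b₁ ≤ 1`. [folklore] -/
theorem sectorProfile_le_one (r : ℝ) : sectorProfile r ≤ 1 := Real.smoothTransition.le_one _

/-- `b₁` has compact support (in `[-¾, ¾]`). [folklore] -/
theorem hasCompactSupport_sectorProfile : HasCompactSupport sectorProfile := by
  refine HasCompactSupport.intro (K := Icc (-(3 / 4 : ℝ)) (3 / 4)) isCompact_Icc fun r hr => ?_
  apply sectorProfile_eq_zero
  rw [mem_Icc, not_and_or, not_le, not_le] at hr
  rcases hr with hr | hr
  · rw [abs_of_neg (by linarith)]
    linarith
  · rw [abs_of_pos (by linarith)]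
    linarith

/-! ### §2 The locally finite periodic sum `S₁(r) = Σ_{j ∈ ℤ} b₁(r - j)` -/

/-- Integer translates far from `r` do not contribute: `|r - j| ≥ ¾ ⟹ b₁(r - j) = 0`. [folklore] -/
theorem sectorProfile_sub_eq_zero {r : ℝ} {j : ℤ} (h : 3 / 4 ≤ |r - j|) : sectorProfile (r - j) = 0 :=
  sectorProfile_eq_zero h

/-- Near `r₀` only the translates by `⌊r₀⌋` and `⌊r₀⌋ + 1` can be non-zero: for `|r - r₀| < ¼` and
`j ∉ {⌊r₀⌋, ⌊r₀⌋ + 1}`, `b₁(r - j) = 0`. [folklore] -/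
theorem sectorProfile_sub_eq_zero_of_notMem {r₀ r : ℝ} (hr : |r - r₀| < 1 / 4) {j : ℤ}
    (hj : j ∉ ({⌊r₀⌋, ⌊r₀⌋ + 1} : Finset ℤ)) : sectorProfile (r - j) = 0 := by
  apply sectorProfile_sub_eq_zero
  by_contra h
  push Not at h
  -- `|r₀ - j| < 1`, so `j ∈ {⌊r₀⌋, ⌊r₀⌋+1}`
  have h1 : |r₀ - j| < 1 := by
    have := abs_sub_le r₀ r (j : ℝ)
    rw [abs_sub_comm r₀ r] at this
    linarith
  rw [abs_lt] at h1
  have hfl := Int.floor_le r₀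
  have hlt := Int.lt_floor_add_one r₀
  simp only [Finset.mem_insert, Finset.mem_singleton, not_or] at hj
  rcases lt_trichotomy j ⌊r₀⌋ with hlt' | heq | hgt
  · have : (j : ℝ) + 1 ≤ ⌊r₀⌋ := by exact_mod_cast hlt'
    linarith
  · exact hj.1 heq
  · have h2 : ⌊r₀⌋ + 2 ≤ j := by
      have : ⌊r₀⌋ + 1 < j := lt_of_le_of_ne (by omega) (Ne.symm hj.2)
      omega
    have : ((⌊r₀⌋ : ℤ) : ℝ) + 2 ≤ j := by exact_mod_cast h2
    linarith

/-- `S₁(r) = Σ_{j ∈ ℤ} b₁(r - j)` (an unconditional sum with finitely many non-zero terms). [folklore] -/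
def sectorProfileSum (r : ℝ) : ℝ := ∑' j : ℤ, sectorProfile (r - j)

/-- The family `j ↦ b₁(r - j)` has finite support, hence is summable. [folklore] -/
theorem summable_sectorProfile_sub (r : ℝ) : Summable fun j : ℤ => sectorProfile (r - j) :=
  summable_of_ne_finset_zero fun j hj =>
    sectorProfile_sub_eq_zero_of_notMem (r₀ := r) (by simp) hj

/-- Local finiteness: near `r₀`, `S₁(r) = b₁(r - ⌊r₀⌋) + b₁(r - ⌊r₀⌋ - 1)` (as a sum over the two
indices). [folklore] -/
theorem sectorProfileSum_eventuallyEq (r₀ : ℝ) :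
    sectorProfileSum =ᶠ[𝓝 r₀] fun r => ∑ j ∈ ({⌊r₀⌋, ⌊r₀⌋ + 1} : Finset ℤ), sectorProfile (r - j) := by
  have hball : ball r₀ (1 / 4) ∈ 𝓝 r₀ := ball_mem_nhds r₀ (by norm_num)
  filter_upwards [hball] with r hr
  rw [mem_ball, Real.dist_eq] at hr
  exact tsum_eq_sum fun j hj => sectorProfile_sub_eq_zero_of_notMem hr hj

/-- **`S₁` is smooth** (locally a finite sum of smooth functions). [folklore] -/
theorem contDiff_sectorProfileSum {m : ℕ∞} : ContDiff ℝ m sectorProfileSum := by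
  refine contDiff_iff_contDiffAt.2 fun r₀ => ?_
  refine (ContDiffAt.congr_of_eventuallyEq ?_ (sectorProfileSum_eventuallyEq r₀))
  refine ContDiffAt.sum fun j _ => ?_
  exact (contDiff_sectorProfile.comp (contDiff_id.sub contDiff_const)).contDiffAt

/-- **`S₁` is `1`-periodic**: `S₁(r + m) = S₁(r)` for every integer `m`. [folklore] -/
theorem sectorProfileSum_add_int (r : ℝ) (m : ℤ) : sectorProfileSum (r + m) = sectorProfileSum r := by
  unfold sectorProfileSum
  rw [← (Equiv.addRight m).tsum_eq (fun j : ℤ => sectorProfile (r + m - j))]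
  refine tsum_congr fun j => ?_
  simp only [Equiv.coe_addRight, Int.cast_add]
  ring_nf

/-- `S₁(r - m) = S₁(r)`. [folklore] -/
theorem sectorProfileSum_sub_int (r : ℝ) (m : ℤ) : sectorProfileSum (r - m) = sectorProfileSum r := by
  have := sectorProfileSum_add_int (r - m) m
  rw [sub_add_cancel] at this
  exact this.symm

/-- **`S₁ ≥ 1`**: the translate by the nearest integer contributes `1`. [folklore] -/
theorem one_le_sectorProfileSum (r : ℝ) : 1 ≤ sectorProfileSum r := by
  have h1 : sectorProfile (r - round r) = 1 := sectorProfile_eq_one (abs_sub_round r)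
  calc (1 : ℝ) = sectorProfile (r - round r) := h1.symm
    _ ≤ sectorProfileSum r := (summable_sectorProfile_sub r).le_tsum (round r) fun j _ => sectorProfile_nonneg _

/-- `S₁ > 0`. [folklore] -/
theorem sectorProfileSum_pos (r : ℝ) : 0 < sectorProfileSum r := lt_of_lt_of_le one_pos (one_le_sectorProfileSum r)

/-- Near the origin only `j = 0` contributes: `|r| ≤ ¼ ⟹ S₁(r) = 1`. [folklore] -/
theorem sectorProfileSum_eq_one {r : ℝ} (hr : |r| ≤ 1 / 4) : sectorProfileSum r = 1 := by
  unfold sectorProfileSum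
  rw [tsum_eq_single 0]
  · simpa using sectorProfile_eq_one (r := r) (by linarith [abs_nonneg r])
  · intro j hj
    apply sectorProfile_sub_eq_zero
    have h1 : (1 : ℝ) ≤ |(j : ℝ)| := by exact_mod_cast Int.one_le_abs hj
    have := abs_sub_abs_le_abs_sub (j : ℝ) r
    rw [abs_sub_comm] at this
    linarith

/-! ### §3 The unit partition function `Z₁ = b₁ / S₁` -/

/-- `Z₁ = b₁ / S₁`. [folklore] -/
def sectorUnitWeight (r : ℝ) : ℝ := sectorProfile r / sectorProfileSum r

/-- `Z₁` is smooth. [folklore] -/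
theorem contDiff_sectorUnitWeight {m : ℕ∞} : ContDiff ℝ m sectorUnitWeight :=
  contDiff_sectorProfile.div contDiff_sectorProfileSum fun r => (sectorProfileSum_pos r).ne'

/-- `0 ≤ Z₁`. [folklore] -/
theorem sectorUnitWeight_nonneg (r : ℝ) : 0 ≤ sectorUnitWeight r :=
  div_nonneg (sectorProfile_nonneg r) (sectorProfileSum_pos r).le

/-- `Z₁ ≤ 1`. [folklore] -/
theorem sectorUnitWeight_le_one (r : ℝ) : sectorUnitWeight r ≤ 1 :=
  (div_le_one (sectorProfileSum_pos r)).2 ((sectorProfile_le_one r).trans (one_le_sectorProfileSum r))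

/-- **Plateau**: `|r| ≤ ¼ ⟹ Z₁(r) = 1`. [folklore] -/
theorem sectorUnitWeight_eq_one {r : ℝ} (hr : |r| ≤ 1 / 4) : sectorUnitWeight r = 1 := by
  rw [sectorUnitWeight, sectorProfileSum_eq_one hr, div_one, sectorProfile_eq_one (by linarith [abs_nonneg r])]

/-- **Support**: `|r| ≥ ¾ ⟹ Z₁(r) = 0`. [folklore] -/
theorem sectorUnitWeight_eq_zero {r : ℝ} (hr : 3 / 4 ≤ |r|) : sectorUnitWeight r = 0 := by
  rw [sectorUnitWeight, sectorProfile_eq_zero hr, zero_div]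

/-- `Z₁` has compact support. [folklore] -/
theorem hasCompactSupport_sectorUnitWeight : HasCompactSupport sectorUnitWeight :=
  hasCompactSupport_sectorProfile.mono fun r hr => by
    rw [Function.mem_support] at hr ⊢
    intro h
    exact hr (by rw [sectorUnitWeight, h, zero_div])

/-- **The partition identity on the line**: `Σ_{j ∈ ℤ} Z₁(s - j) = 1` for every `s`. [folklore] -/
theorem tsum_sectorUnitWeight_sub_int (s : ℝ) : ∑' j : ℤ, sectorUnitWeight (s - j) = 1 := by
  have h : ∀ j : ℤ, sectorUnitWeight (s - j) = sectorProfile (s - j) / sectorProfileSum s := fun j => by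
    rw [sectorUnitWeight, sectorProfileSum_sub_int]
  simp_rw [h]
  rw [tsum_div_const, ← sectorProfileSum, div_self (sectorProfileSum_pos s).ne']

/-- All derivatives of `Z₁` have compact support. [folklore] -/
theorem hasCompactSupport_iteratedDeriv_sectorUnitWeight : ∀ m : ℕ, HasCompactSupport (iteratedDeriv m sectorUnitWeight)
  | 0 => by simpa using hasCompactSupport_sectorUnitWeight
  | m + 1 => by
    rw [iteratedDeriv_succ]
    exact (hasCompactSupport_iteratedDeriv_sectorUnitWeight m).deriv

/-- **Every derivative of `Z₁` is bounded.** [folklore] -/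
theorem exists_bound_iteratedDeriv_sectorUnitWeight (m : ℕ) :
    ∃ C : ℝ, 0 ≤ C ∧ ∀ r : ℝ, |iteratedDeriv m sectorUnitWeight r| ≤ C := by
  obtain ⟨C, hC⟩ := ((contDiff_sectorUnitWeight (m := ⊤)).continuous_iteratedDeriv m (by exact_mod_cast le_top)).bounded_above_of_compact_support
    (hasCompactSupport_iteratedDeriv_sectorUnitWeight m)
  refine ⟨max C 0, le_max_right _ _, fun r => ?_⟩
  rw [← Real.norm_eq_abs]
  exact (hC r).trans (le_max_left _ _)

/-! ### §4 The sector weights `ζ_{n,j}(θ) = Z₁(θ/w_n - j - ½)` -/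

/-- **The sector weight** `ζ_{n,j}(θ) = Z₁(θ/w_n - j - ½)`: the smooth cutoff of the interval of
length `w_n = π/2^n` centred at `(j + ½) w_n` (for `j ∈ {0,…,2^{n+1}-1}` this centre is
`sectorCenter n j = θ_{h,ω}` of BGM (2.45)), for every integer `j`. [cite: BenfattoGiulianiMastropietro2006, §2.5 (2.45)] -/
def sectorWeight (n : ℕ) (j : ℤ) (θ : ℝ) : ℝ := sectorUnitWeight (θ / sectorWidth n - j - 1 / 2)

/-- The sector weight as a rescaled translate of `Z₁`: `ζ_{n,j}(θ) = Z₁(w_n⁻¹ θ - (j + ½))`. [folklore] -/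
theorem sectorWeight_eq (n : ℕ) (j : ℤ) :
    sectorWeight n j = fun θ => (fun y => sectorUnitWeight (y - ((j : ℝ) + 1 / 2))) ((sectorWidth n)⁻¹ * θ) := by
  funext θ
  simp only [sectorWeight, div_eq_inv_mul]
  ring_nf

/-- For natural indices the centre is `sectorCenter`: `(j + ½) w_n = sectorCenter n j`. [folklore] -/
theorem sectorCenter_eq (n j : ℕ) : sectorCenter n j = ((j : ℤ) + 1 / 2 : ℝ) * sectorWidth n := by
  simp [sectorCenter]

/-- `ζ_{n,j}` is smooth. [cite: BenfattoGiulianiMastropietro2006, §2.5 (2.45)] -/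
theorem contDiff_sectorWeight (n : ℕ) (j : ℤ) {m : ℕ∞} : ContDiff ℝ m (sectorWeight n j) := by
  unfold sectorWeight
  exact contDiff_sectorUnitWeight.comp (((contDiff_id.div_const _).sub contDiff_const).sub contDiff_const)

/-- `0 ≤ ζ_{n,j} ≤ 1`. [folklore] -/
theorem sectorWeight_mem_Icc (n : ℕ) (j : ℤ) (θ : ℝ) : sectorWeight n j θ ∈ Icc (0 : ℝ) 1 :=
  ⟨sectorUnitWeight_nonneg _, sectorUnitWeight_le_one _⟩

/-- The rescaled distance to the centre. [folklore] -/
theorem abs_div_sectorWidth_sub (n : ℕ) (j : ℤ) (θ : ℝ) :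
    |θ / sectorWidth n - j - 1 / 2| = |θ - ((j : ℝ) + 1 / 2) * sectorWidth n| / sectorWidth n := by
  have hw := sectorWidth_pos n
  rw [← abs_of_pos hw, ← abs_div, abs_of_pos hw]
  congr 1
  field_simp
  ring

/-- **Plateau** (BGM (2.45), first property, with room to spare): `|θ - (j+½)w_n| ≤ w_n/4 ⟹ ζ_{n,j}(θ) = 1`. [cite: BenfattoGiulianiMastropietro2006, §2.5 (2.45)] -/
theorem sectorWeight_eq_one {n : ℕ} {j : ℤ} {θ : ℝ}
    (h : |θ - ((j : ℝ) + 1 / 2) * sectorWidth n| ≤ sectorWidth n / 4) : sectorWeight n j θ = 1 := by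
  have hw := sectorWidth_pos n
  apply sectorUnitWeight_eq_one
  rw [abs_div_sectorWidth_sub, div_le_iff₀ hw]
  linarith

/-- **Support** (BGM (2.45), second property): `|θ - (j+½)w_n| ≥ 3w_n/4 ⟹ ζ_{n,j}(θ) = 0`. [cite: BenfattoGiulianiMastropietro2006, §2.5 (2.45)] -/
theorem sectorWeight_eq_zero {n : ℕ} {j : ℤ} {θ : ℝ}
    (h : 3 * sectorWidth n / 4 ≤ |θ - ((j : ℝ) + 1 / 2) * sectorWidth n|) : sectorWeight n j θ = 0 := by
  have hw := sectorWidth_pos n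
  apply sectorUnitWeight_eq_zero
  rw [abs_div_sectorWidth_sub, le_div_iff₀ hw]
  linarith

/-- **Partition of unity** (BGM (2.45), third property, on the line): `Σ_{j ∈ ℤ} ζ_{n,j}(θ) = 1`
for every real `θ`. [cite: BenfattoGiulianiMastropietro2006, §2.5 (2.45)] -/
theorem tsum_sectorWeight (n : ℕ) (θ : ℝ) : ∑' j : ℤ, sectorWeight n j θ = 1 := by
  have h : ∀ j : ℤ, sectorWeight n j θ = sectorUnitWeight ((θ / sectorWidth n - 1 / 2) - j) := fun j => by
    rw [sectorWeight]; ring_nf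
  simp_rw [h]
  exact tsum_sectorUnitWeight_sub_int _

/-- The family `j ↦ ζ_{n,j}(θ)` is summable (finitely many non-zero terms). [folklore] -/
theorem summable_sectorWeight (n : ℕ) (θ : ℝ) : Summable fun j : ℤ => sectorWeight n j θ := by
  by_contra h
  have := tsum_sectorWeight n θ
  rw [tsum_eq_zero_of_not_summable h] at this
  exact zero_ne_one this

/-- **`2π`-covariance**: shifting the index by `N = 2^{n+1}` is the same as turning once,
`ζ_{n,j+N}(θ + 2π) = ζ_{n,j}(θ)` (since `N w_n = 2π`). [cite: BenfattoGiulianiMastropietro2006, §2.5 (2.45)] -/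
theorem sectorWeight_add_sectorCount_add_two_pi (n : ℕ) (j : ℤ) (θ : ℝ) :
    sectorWeight n (j + sectorCount n) (θ + 2 * π) = sectorWeight n j θ := by
  have hw := sectorWidth_pos n
  have hN := sectorCount_mul_sectorWidth n
  unfold sectorWeight
  congr 1
  push_cast
  field_simp
  linarith [hN]

/-- Iterated derivatives of the sector weight: `ζ_{n,j}^{(m)}(θ) = w_n^{-m} Z₁^{(m)}(θ/w_n - j - ½)`. [folklore] -/
theorem iteratedDeriv_sectorWeight (n : ℕ) (j : ℤ) (m : ℕ) (θ : ℝ) :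
    iteratedDeriv m (sectorWeight n j) θ =
      (sectorWidth n)⁻¹ ^ m * iteratedDeriv m sectorUnitWeight (θ / sectorWidth n - j - 1 / 2) := by
  have hg : ContDiff ℝ m (fun y : ℝ => sectorUnitWeight (y - ((j : ℝ) + 1 / 2))) :=
    contDiff_sectorUnitWeight.comp (contDiff_id.sub contDiff_const)
  rw [sectorWeight_eq, iteratedDeriv_comp_const_mul hg, iteratedDeriv_comp_sub_const]
  simp only [div_eq_inv_mul]
  ring_nf

/-- **Scale-covariant derivative bounds** (the `γ^{-h/2}` per derivative of BGM's Lemma 2.2 /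
BGM 2003 §7.2): for every `m` there is `C_m` with `|ζ_{n,j}^{(m)}(θ)| ≤ C_m w_n^{-m}` for all
`n, j, θ`. [cite: BenfattoGiulianiMastropietro2006, §2.5 Lemma 2.2] -/
theorem abs_iteratedDeriv_sectorWeight_le (m : ℕ) :
    ∃ C : ℝ, 0 ≤ C ∧ ∀ (n : ℕ) (j : ℤ) (θ : ℝ),
      |iteratedDeriv m (sectorWeight n j) θ| ≤ C * (sectorWidth n)⁻¹ ^ m := by
  obtain ⟨C, hC0, hC⟩ := exists_bound_iteratedDeriv_sectorUnitWeight m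
  refine ⟨C, hC0, fun n j θ => ?_⟩
  have hw := sectorWidth_pos n
  rw [iteratedDeriv_sectorWeight, abs_mul, abs_of_pos (by positivity), mul_comm]
  exact mul_le_mul_of_nonneg_right (hC _) (by positivity)


/-! ### §5 Decomposition of integrals over a period -/

section PeriodIntegral

open MeasureTheory intervalIntegral

/-- On `[0, 2π]` only the weights with `-N ≤ j < 2N` can be non-zero (`N = 2^{n+1}`; in fact only
`-1 ≤ j ≤ N`). [folklore] -/
theorem sectorWeight_eq_zero_of_notMem_Ico {n : ℕ} {θ : ℝ} (hθ : θ ∈ Icc (0 : ℝ) (2 * π)) {j : ℤ}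
    (hj : j ∉ Finset.Ico (-(sectorCount n : ℤ)) (2 * sectorCount n)) : sectorWeight n j θ = 0 := by
  have hw := sectorWidth_pos n
  have hN := sectorCount_mul_sectorWidth n
  have hN1 : (1 : ℝ) ≤ sectorCount n := by exact_mod_cast Nat.one_le_two_pow
  apply sectorWeight_eq_zero
  rw [Finset.mem_Ico, not_and_or, not_le, not_lt] at hj
  rcases hj with hj | hj
  · -- `j ≤ -N - 1`: the centre is below `-2π - w/2`
    have hj' : (j : ℝ) + 1 ≤ -(sectorCount n : ℝ) := by exact_mod_cast hj
    rw [abs_of_nonneg (by nlinarith [hθ.1])]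
    nlinarith [hθ.1]
  · -- `j ≥ 2N`: the centre is above `4π + w/2`
    have hj' : 2 * (sectorCount n : ℝ) ≤ j := by exact_mod_cast hj
    rw [abs_of_nonpos (by nlinarith [hθ.2])]
    nlinarith [hθ.2]

/-- A shifted copy of `range N` inside `ℤ` is an integer interval. [folklore] -/
theorem image_natCast_add_range (N : ℕ) (c : ℤ) :
    (Finset.range N).image (fun o : ℕ => (o : ℤ) + c) = Finset.Ico c (c + N) := by
  ext x
  simp only [Finset.mem_image, Finset.mem_range, Finset.mem_Ico]
  constructor
  · rintro ⟨o, ho, rfl⟩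
    constructor <;> omega
  · intro hx
    refine ⟨(x - c).toNat, ?_, ?_⟩ <;> omega

/-- Summing a function over the three shifts `ω - N, ω, ω + N`, `ω < N`, is summing it over
`-N ≤ j < 2N`. [folklore] -/
theorem sum_range_shifts_eq_sum_Ico (N : ℕ) (f : ℤ → ℝ) :
    ∑ o ∈ Finset.range N, (f ((o : ℤ) - N) + f o + f ((o : ℤ) + N)) =
      ∑ j ∈ Finset.Ico (-(N : ℤ)) (2 * N), f j := by
  have hinj : ∀ c : ℤ, Set.InjOn (fun o : ℕ => (o : ℤ) + c) (Finset.range N) := fun c a _ b _ h => by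
    simpa using h
  rw [Finset.sum_add_distrib, Finset.sum_add_distrib]
  have h1 : ∑ o ∈ Finset.range N, f ((o : ℤ) - N) = ∑ j ∈ Finset.Ico (-(N : ℤ)) 0, f j := by
    have : ∑ o ∈ Finset.range N, f ((o : ℤ) - N) = ∑ o ∈ Finset.range N, f ((fun o : ℕ => (o : ℤ) + -(N : ℤ)) o) := by
      simp [sub_eq_add_neg]
    rw [this, ← Finset.sum_image (hinj (-(N : ℤ))), image_natCast_add_range, neg_add_cancel]
  have h2 : ∑ o ∈ Finset.range N, f (o : ℤ) = ∑ j ∈ Finset.Ico (0 : ℤ) N, f j := by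
    have : ∑ o ∈ Finset.range N, f (o : ℤ) = ∑ o ∈ Finset.range N, f ((fun o : ℕ => (o : ℤ) + 0) o) := by simp
    rw [this, ← Finset.sum_image (hinj 0), image_natCast_add_range, zero_add]
  have h3 : ∑ o ∈ Finset.range N, f ((o : ℤ) + N) = ∑ j ∈ Finset.Ico (N : ℤ) (2 * N), f j := by
    rw [← Finset.sum_image (hinj (N : ℤ)), image_natCast_add_range]
    congr 1
    congr 1
    ring
  rw [h1, h2, h3, ← Finset.sum_union (Finset.Ico_disjoint_Ico_consecutive _ _ _),
    Finset.Ico_union_Ico_eq_Ico (by omega) (by omega),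
    ← Finset.sum_union (Finset.Ico_disjoint_Ico_consecutive _ _ _),
    Finset.Ico_union_Ico_eq_Ico (by omega) (by omega)]

/-- **The three shifts of the `N` weights sum to `1` on a period**: for `θ ∈ [0, 2π]`,
`Σ_{ω<N} (ζ_{n,ω-N} + ζ_{n,ω} + ζ_{n,ω+N})(θ) = 1`. [cite: BenfattoGiulianiMastropietro2006, §2.5 (2.45)] -/
theorem sum_sectorWeight_shifts_eq_one (n : ℕ) {θ : ℝ} (hθ : θ ∈ Icc (0 : ℝ) (2 * π)) :
    ∑ o ∈ Finset.range (sectorCount n),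
      (sectorWeight n ((o : ℤ) - sectorCount n) θ + sectorWeight n o θ + sectorWeight n ((o : ℤ) + sectorCount n) θ) = 1 := by
  rw [sum_range_shifts_eq_sum_Ico (sectorCount n) (fun j => sectorWeight n j θ), ← tsum_sectorWeight n θ]
  exact (tsum_eq_sum fun j hj => sectorWeight_eq_zero_of_notMem_Ico hθ hj).symm

variable {E : Type*} [NormedAddCommGroup E] [NormedSpace ℝ E]

/-- **Decomposition of an integral over a period into sector pieces**: for a continuous
`2π`-periodic `g`, `∫₀^{2π} g = Σ_{ω<N} ∫_{-2π}^{4π} ζ_{n,ω}(θ) g(θ) dθ` — each summand involves a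
single smooth compactly supported weight; the three windows `[-2π,0], [0,2π], [2π,4π]` of the
right-hand side reassemble, by periodicity of `g` and `2π`-covariance of the weights, the partition
of unity on `[0, 2π]`. [cite: BenfattoGiulianiMastropietro2006, §2.5 (2.45)] -/
theorem intervalIntegral_period_eq_sum_sectorWeight (n : ℕ) {g : ℝ → E} (hg : Function.Periodic g (2 * π))
    (hgc : Continuous g) :
    ∫ θ in (0:ℝ)..2 * π, g θ =
      ∑ o ∈ Finset.range (sectorCount n), ∫ θ in (-(2 * π))..(4 * π), sectorWeight n o θ • g θ := by
  set N := sectorCount n with hNdef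
  have hcw : ∀ j : ℤ, Continuous fun θ => sectorWeight n j θ • g θ := fun j =>
    ((contDiff_sectorWeight n j (m := 0)).continuous).smul hgc
  have hint : ∀ (j : ℤ) (a b : ℝ), IntervalIntegrable (fun θ => sectorWeight n j θ • g θ) volume a b :=
    fun j a b => (hcw j).intervalIntegrable a b
  -- split each window `[-2π, 4π] = [-2π, 0] ∪ [0, 2π] ∪ [2π, 4π]` and shift the outer pieces
  have hsplit : ∀ o : ℕ, ∫ θ in (-(2 * π))..(4 * π), sectorWeight n o θ • g θ =
      ∫ θ in (0:ℝ)..2 * π, (sectorWeight n ((o : ℤ) - N) θ + sectorWeight n o θ +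
        sectorWeight n ((o : ℤ) + N) θ) • g θ := by
    intro o
    rw [← integral_add_adjacent_intervals (hint o _ 0) (hint o 0 _),
      ← integral_add_adjacent_intervals (hint o 0 (2 * π)) (hint o (2 * π) _)]
    -- left piece: substitute `θ ↦ θ - 2π`
    have hL : ∫ θ in (-(2 * π))..0, sectorWeight n o θ • g θ =
        ∫ θ in (0:ℝ)..2 * π, sectorWeight n ((o : ℤ) + N) θ • g θ := by
      have h := intervalIntegral.integral_comp_sub_right (fun θ => sectorWeight n o θ • g θ) (2 * π)
        (a := 0) (b := 2 * π)
      rw [zero_sub, sub_self] at h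
      rw [← h]
      refine integral_congr fun θ _ => ?_
      rw [hg.sub_eq, ← sectorWeight_add_sectorCount_add_two_pi n o (θ - 2 * π), sub_add_cancel]
    -- right piece: substitute `θ ↦ θ + 2π`
    have hR : ∫ θ in (2 * π)..(4 * π), sectorWeight n o θ • g θ =
        ∫ θ in (0:ℝ)..2 * π, sectorWeight n ((o : ℤ) - N) θ • g θ := by
      have h := intervalIntegral.integral_comp_add_right (fun θ => sectorWeight n o θ • g θ) (2 * π)
        (a := 0) (b := 2 * π)
      rw [zero_add, show 2 * π + 2 * π = 4 * π by ring] at h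
      rw [← h]
      refine integral_congr fun θ _ => ?_
      have hcov := sectorWeight_add_sectorCount_add_two_pi n ((o : ℤ) - N) θ
      rw [sub_add_cancel] at hcov
      rw [hg, hcov]
    rw [hL, hR, ← integral_add (hint _ _ _) (hint _ _ _), ← integral_add (hint _ _ _) ((hint _ _ _).add (hint _ _ _))]
    refine integral_congr fun θ _ => ?_
    simp only [add_smul]
    abel
  simp_rw [hsplit]
  have hint3 : ∀ o ∈ Finset.range N, IntervalIntegrable
      (fun θ => (sectorWeight n ((o : ℤ) - N) θ + sectorWeight n o θ + sectorWeight n ((o : ℤ) + N) θ) • g θ)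
      volume 0 (2 * π) := by
    intro o _
    refine (Continuous.smul ?_ hgc).intervalIntegrable _ _
    exact (((contDiff_sectorWeight n _ (m := 0)).continuous.add (contDiff_sectorWeight n _ (m := 0)).continuous).add
      (contDiff_sectorWeight n _ (m := 0)).continuous)
  rw [← integral_finsetSum hint3]
  refine integral_congr fun θ hθ => ?_
  rw [uIcc_of_le (by positivity)] at hθ
  rw [← Finset.sum_smul, sum_sectorWeight_shifts_eq_one n hθ, one_smul]

end PeriodIntegral

/-! ### §6 Two more interface lemmas for the profile `b₁`

Positivity of `b₁` on its open support and evenness, stated next to the §1 interface so that no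
file outside this one has to unfold `sectorProfile` (consumers: the s-sector nesting
`SSectorNesting.sectorProfile_pos` and the reflection symmetry of the master symbol
`SectorSymbolMasterBox.sectorProfile_neg`). -/

/-- The profile is positive on its open support: `|r| < ¾ ⟹ 0 < b₁(r)` (the cutoff `ζ_{h,ω}` of
(2.45) is non-zero exactly on the open sector of half-width `(3π/4)γ^{h/2}`). [cite: BenfattoGiulianiMastropietro2006, §2.5 (2.45)] -/
theorem sectorProfile_pos_of_abs_lt {r : ℝ} (hr : |r| < 3 / 4) : 0 < sectorProfile r := by
  have h : r ^ 2 < (3 / 4 : ℝ) ^ 2 := by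
    rw [← sq_abs r]
    exact pow_lt_pow_left₀ hr (abs_nonneg r) two_ne_zero
  exact Real.smoothTransition.pos_of_pos (by nlinarith [h])

/-- The profile is even: `b₁(-r) = b₁(r)` (the cutoff `ζ_{h,ω}` of (2.45) is symmetric about the
sector centre `θ_{h,ω}`). [cite: BenfattoGiulianiMastropietro2006, §2.5 (2.45)] -/
theorem sectorProfile_neg_eq (r : ℝ) : sectorProfile (-r) = sectorProfile r := by
  simp only [sectorProfile, neg_sq]

end Literature.MathematicalPhysics.QuantumLattice

end
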